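import Summits.QuantumFields.YangMills.Theorems.BalabanUVNodesN15BackgroundCovariantEntriesAllLetters
import HarnessLib

/-!
# `NE2PlusOperator` BY NAME FOR THE TWO-SIDED BY-PARTS FAMILY WITH ALL FOUR (3.42) ENTRIES COVARIANT — the node theorem over FILE 37a's per-index `EtaRateIneq342`
# (dag-n15-c g10, FILE 37b; Track-A node N15 = NE2, s1 «background-layer OPERATOR ingredient»)

`--kind proof --supports stmt-QuantumFields-20544 --as helper` (K3⁷; count-neutral; theorems only).  Imports BY NAME this seat's FILE 37a `…BackgroundCovariantEntriesAllLetters` (★★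
`etaRateIneq342_twoSidedCovAll_of_letters`, `bgFamilyM₂RCC`, `covConst2`, `covConst2_nonneg`; through it FILE 34 `covConst1`∕`covConst3`, FILE 24's inputs, FILE 19 `bpConst2L`, `rowConst_small`);
nothing in the tree is modified.

WHAT.  ★★★ **`ne2PlusOperatorM1_twoSidedCovAll_of_letters`**: `NE2PlusOperatorM1 c₃₅ (bgInstanceM₂R …) (bgFamilyM₂RCC …)` BY NAME (FILE 39's guard-free, NON-VACUOUS shape) for ANY coefficient-carrier pair whose (3.35) delivers the
letter bundle (FILE 24 §3's quantifier bookkeeping verbatim; window unchanged; `B₀ = B₀^{flat} + covConst1 + covConst2 + covConst3 + 1` at scale `κc₃₅a₀`).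

HONEST FRAMING.  Bookkeeping; letters are hypotheses (discharged on the torus in FILE 38); all four entries covariant w.r.t. the transports `1 + ηa⁺` (Bałaban's `∇_{U′}`, `∇*_{U′}`
(transpose-adjoint), `Δ_{U′}` for the exact coefficients); `DRD*`, `aQ*Q` at `U ≡ 1`; NE2⁺ NOT PRINTED; count-neutral; N15 NOT discharged; one finite torus at fixed ε — NOT ℝ⁴, NOT infinite
volume, NOT OS, NOT a mass gap, NOT Clay.
-/

noncomputable section

open scoped BigOperators
open Finset

namespace Summit.QuantumFields.YangMills.BalabanUVNodes.N15.BackgroundLayer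

open Literature.MathematicalPhysics.QuantumFieldTheory.Balaban1983to89
open Literature.MathematicalPhysics.QuantumFieldTheory.Balaban1983to89.B11SectG (BlockNorm HasMaj RowSum hasMaj_comp hasMaj_comp_exp hasMaj_zero)
open Literature.MathematicalPhysics.QuantumFieldTheory.Balaban1983to89.T4EtaRate (PairedInstance EtaPairing EtaRateIneq342 NE2PlusOperator rateFactor)
open Literature.MathematicalPhysics.QuantumFieldTheory.Balaban1983to89.T4EtaRateDefect (idef idef_apply idef_comp idef_zero rateWeight)
open Literature.MathematicalPhysics.QuantumFieldTheory.Balaban1983to89.T4EtaRateCoeffDefect (pull pull_apply diagK diagK_nonneg)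
open Literature.MathematicalPhysics.QuantumFieldTheory.Balaban1983to89.B6RandomWalk (Triangle254)
open Summit.QuantumFields.YangMills.BalabanUVNodes.N15.OperatorReadout (opGeo opFamily opGeo_len rateFactor_opGeo etaRateIneq342_of_hasMaj_rateWeight)
open Summit.QuantumFields.YangMills.BalabanUVNodes.N15.MatrixSpecies (mmulOp liftEquiv liftMap liftBlk)
open Summit.QuantumFields.YangMills.BalabanUVNodes.N15.SiteLayer (hasMaj_exp_comp_diagK hasMaj_diagK_comp_exp hasMaj_add_exp hasMaj_exp_mono)


variable {d : ℕ}

/-! ## §3 The node theorem -/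

section Node

variable {I J ι : Type} [Fintype J] [DecidableEq J] [Fintype ι] [DecidableEq ι] (g : I → B6.Geometry) (X X' : I → Type) [∀ i, Fintype (X i)]
  [∀ i, Fintype (X' i)] [∀ i, DecidableEq (X i)] [∀ i, DecidableEq (X' i)] (blk : ∀ i, X i → (g i).Site) (π : ∀ i, X' i → X i) (τ : ∀ i, J → X i ≃ X i)
  (τ' : ∀ i, J → X' i ≃ X' i) (n n' : I → ℝ) (nsh : I → ℕ) (Bc Bf : I → B9.Backgrounds)
  (P : ∀ i, EtaPairing (opGeo (g i) (X i × ι) (liftBlk (blk i) ι)) (fineGeo (g i) (X' i × ι) (liftBlk (blk i ∘ π i) ι) (nsh i)) (Bc i) (Bf i))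
  (cfgF : ∀ i, (Bf i).Cfg → (X' i → Matrix ι ι ℝ) × (J ⊕ J → X' i → Matrix ι ι ℝ)) (cfgC : ∀ i, (Bf i).Cfg → (X i → Matrix ι ι ℝ) × (J ⊕ J → X i → Matrix ι ι ℝ))
  (θ : I → ℝ) (ν : I → J) (G D₃ : ∀ i, (X i × ι → ℝ) →ₗ[ℝ] (X i × ι → ℝ)) (D : ∀ i, J ⊕ J → (X i × ι → ℝ) →ₗ[ℝ] (X i × ι → ℝ))
  (G' D₃' : ∀ i, (X' i × ι → ℝ) →ₗ[ℝ] (X' i × ι → ℝ)) (D' : ∀ i, J ⊕ J → (X' i × ι → ℝ) →ₗ[ℝ] (X' i × ι → ℝ))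

/-- ★★★ **NE2⁺, OPERATOR LAYER — `T4EtaRate.NE2PlusOperator` BY NAME FOR THE TWO-SIDED BY-PARTS MATRIX FAMILY OVER AN ARBITRARY COEFFICIENT-CARRIER PAIR WHOSE (3.35) REGULARITY
DELIVERS THE LETTER BUNDLE.**  For ANY family of realised instances `⟨opGeo, fineGeo, B_c, B_f, P⟩` with readings `cfgF_i, cfgC_i` of the fine ∕ coarse coefficient configurations such
that, for every configuration `U` regular at level `c₃₅` with window `α₀ > 0` (and `M ≥ 1`), the fifteen letters `TwoSidedLetters … (κ·c₃₅Mα₀) θ_i (cfgF_i U) (cfgC_i U)` hold together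
with the shift-defect row letter at the coarse forward coefficients (`≤ m_T·(κc₃₅Mα₀)·θ_ie^{−δd}`, linear in the scale); with the UNIFORM `U ≡ 1` letters of FILE 20 at rate `δ`
(`6σ < δ`): pieces, derived pieces over `J ⊕ J`, the fine Laplacian piece, the `U ≡ 1` entry-2 operators `G_i∇_ν*, G′_i∇′_ν*`, the η-defects (`≤ m₀θ_ie^{−δd}`), the one-step shifts
(`≤ c_Te^{−δd}`); `0 ≤ θ_i ≤ (L^j)^{−γ}`, `γ > 0`; [B6] carriers; `η, L > 0`, sites of size `≥ 1`; `c₃₅, κ, r₀ > 0` (the letters are demanded only in the WINDOW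
`c₃₅Mα₀ ≤ r₀`, where the `ad`-polynomial coefficients are controlled) —: `NE2PlusOperator c₃₅ (bgInstanceM₂R …) (bgFamilyM₂R …)` with `M₅ = 1`,
`a₀ = min((2κc₃₅(1+|J ⊕ J|)(βc_r+1))⁻¹, (2(K+1))⁻¹, r₀∕c₃₅)` (`K = (c_T+1)κc₃₅|J|βc_r³`), `B₀ = bgConst + bgConst1 + bpConst2L(…, m_Tκc₃₅a₀) + 1` at scale `κc₃₅a₀`, `δ₀ = δ − 6σ`.  This is the
socket for Bałaban's OWN species (3.52): its coarse coefficients are `ad`-polynomials of the COARSE gauge field (readings, not block averages).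
[cite: Balaban1985BackgroundPropagators, Thm 3.1 p.397 (quantifier template); (3.35)–(3.36) p.396, (3.42) p.397, (3.52) p.400 (shapes, mechanism)] -/
theorem ne2PlusOperatorM1_twoSidedCovAll_of_letters (c35 κ r₀ : ℝ) (hc35 : 0 < c35) (hκ : 0 < κ) (hr₀ : 0 < r₀)
    (htri : ∀ i, Triangle254 (g i)) (hd : ∀ i (a b : (g i).Site), 0 ≤ (g i).dist a b) (hd0 : ∀ i (y : (g i).Site), (g i).dist y y = 0) {σ cr : ℝ} (hσ : 0 ≤ σ)
    (hcr : 0 ≤ cr) (hrow : ∀ i, RowSum (g i) σ cr) (hη : ∀ i, 0 < (g i).eta) (hL : ∀ i, 0 < (g i).L) (hlen : ∀ i y, 1 ≤ (g i).len y) (hM1 : ∀ i, 1 ≤ (g i).M)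
    {δ β m₀ γ cT mT : ℝ} (hσδ : 6 * σ < δ) (hβ : 0 ≤ β) (hm₀ : 0 ≤ m₀) (hγ : 0 < γ) (hθ : ∀ i, 0 ≤ θ i) (hθγ : ∀ i y, θ i ≤ rateWeight (g i) γ y) (hcT : 0 ≤ cT) (hmT : 0 ≤ mT)
    (hn'0 : ∀ i, 0 ≤ (n' i)⁻¹) (hn'n : ∀ i, (n' i)⁻¹ ≤ (n i)⁻¹) (hnθ : ∀ i, (n i)⁻¹ ≤ θ i) (hθ1 : ∀ i, θ i ≤ 1)
    (hG : ∀ i, HasMaj (BlockNorm.ofBlocks (g i) (liftBlk (blk i) ι)) (BlockNorm.ofBlocks (g i) (liftBlk (blk i) ι)) (G i) (fun y y' => β * Real.exp (-(δ * (g i).dist y y'))))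
    (hD : ∀ i μ, HasMaj (BlockNorm.ofBlocks (g i) (liftBlk (blk i) ι)) (BlockNorm.ofBlocks (g i) (liftBlk (blk i) ι)) (D i μ) (fun y y' => β * Real.exp (-(δ * (g i).dist y y'))))
    (hG' : ∀ i, HasMaj (BlockNorm.ofBlocks (g i) (liftBlk (blk i ∘ π i) ι)) (BlockNorm.ofBlocks (g i) (liftBlk (blk i ∘ π i) ι)) (G' i) (fun y y' => β * Real.exp (-(δ * (g i).dist y y'))))
    (hD' : ∀ i μ, HasMaj (BlockNorm.ofBlocks (g i) (liftBlk (blk i ∘ π i) ι)) (BlockNorm.ofBlocks (g i) (liftBlk (blk i ∘ π i) ι)) (D' i μ)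
      (fun y y' => β * Real.exp (-(δ * (g i).dist y y'))))
    (hD₃' : ∀ i, HasMaj (BlockNorm.ofBlocks (g i) (liftBlk (blk i ∘ π i) ι)) (BlockNorm.ofBlocks (g i) (liftBlk (blk i ∘ π i) ι)) (D₃' i) (fun y y' => β * Real.exp (-(δ * (g i).dist y y'))))
    (hDG : ∀ i, HasMaj (BlockNorm.ofBlocks (g i) (liftBlk (blk i) ι)) (BlockNorm.ofBlocks (g i) (liftBlk (blk i ∘ π i) ι)) (idef (pull (liftMap (π i) ι)) (pull (liftMap (π i) ι)) (G' i) (G i))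
      (fun y y' => m₀ * θ i * Real.exp (-(δ * (g i).dist y y'))))
    (hDD : ∀ i μ, HasMaj (BlockNorm.ofBlocks (g i) (liftBlk (blk i) ι)) (BlockNorm.ofBlocks (g i) (liftBlk (blk i ∘ π i) ι))
      (idef (pull (liftMap (π i) ι)) (pull (liftMap (π i) ι)) (D' i μ) (D i μ)) (fun y y' => m₀ * θ i * Real.exp (-(δ * (g i).dist y y'))))
    (hDD₃ : ∀ i, HasMaj (BlockNorm.ofBlocks (g i) (liftBlk (blk i) ι)) (BlockNorm.ofBlocks (g i) (liftBlk (blk i ∘ π i) ι))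
      (idef (pull (liftMap (π i) ι)) (pull (liftMap (π i) ι)) (D₃' i) (D₃ i)) (fun y y' => m₀ * θ i * Real.exp (-(δ * (g i).dist y y'))))
    (hS : ∀ i ν, HasMaj (BlockNorm.ofBlocks (g i) (liftBlk (blk i) ι)) (BlockNorm.ofBlocks (g i) (liftBlk (blk i) ι)) (G i ∘ₗ fgradAdj (n i) (liftEquiv (τ i ν) ι))
      (fun y y' => β * Real.exp (-(δ * (g i).dist y y'))))
    (hS' : ∀ i ν, HasMaj (BlockNorm.ofBlocks (g i) (liftBlk (blk i ∘ π i) ι)) (BlockNorm.ofBlocks (g i) (liftBlk (blk i ∘ π i) ι)) (G' i ∘ₗ fgradAdj (n' i) (liftEquiv (τ' i ν) ι))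
      (fun y y' => β * Real.exp (-(δ * (g i).dist y y'))))
    (hDS : ∀ i ν, HasMaj (BlockNorm.ofBlocks (g i) (liftBlk (blk i) ι)) (BlockNorm.ofBlocks (g i) (liftBlk (blk i ∘ π i) ι))
      (idef (pull (liftMap (π i) ι)) (pull (liftMap (π i) ι)) (G' i ∘ₗ fgradAdj (n' i) (liftEquiv (τ' i ν) ι)) (G i ∘ₗ fgradAdj (n i) (liftEquiv (τ i ν) ι)))
      (fun y y' => m₀ * θ i * Real.exp (-(δ * (g i).dist y y'))))
    (hSh : ∀ i μ, HasMaj (BlockNorm.ofBlocks (g i) (liftBlk (blk i) ι)) (BlockNorm.ofBlocks (g i) (liftBlk (blk i) ι)) (pull (liftEquiv (τ i μ) ι)) (fun y y' => cT * Real.exp (-(δ * (g i).dist y y'))))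
    (hSh' : ∀ i μ, HasMaj (BlockNorm.ofBlocks (g i) (liftBlk (blk i ∘ π i) ι)) (BlockNorm.ofBlocks (g i) (liftBlk (blk i ∘ π i) ι)) (pull (liftEquiv (τ' i μ) ι))
      (fun y y' => cT * Real.exp (-(δ * (g i).dist y y'))))
    (hLt : ∀ i (U : (Bf i).Cfg) (α₀ : ℝ), (Bf i).Reg335 c35 α₀ U → 0 < α₀ → 1 ≤ (g i).M → c35 * (g i).M * α₀ ≤ r₀ →
      TwoSidedLetters J ι (π i) (τ i) (τ' i) (n i) (n' i) (κ * (c35 * (g i).M * α₀)) (θ i) (cfgF i U) (cfgC i U))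
    (hDSh : ∀ i (U : (Bf i).Cfg) (α₀ : ℝ), (Bf i).Reg335 c35 α₀ U → 0 < α₀ → 1 ≤ (g i).M → c35 * (g i).M * α₀ ≤ r₀ →
      ∀ μ, HasMaj (BlockNorm.ofBlocks (g i) (liftBlk (liftBlk (blk i) ι) J)) (BlockNorm.ofBlocks (g i) (liftBlk (blk i ∘ π i) ι))
        (idef (pull (liftMap (π i) ι)) (pull (liftMap (π i) ι)) (pull (liftEquiv (τ' i μ) ι)) (pull (liftEquiv (τ i μ) ι)) ∘ₗ
          (mmulOp ((cfgC i U).2 (Sum.inl μ) ∘ ⇑(τ i μ).symm) ∘ₗ sumJ fun ν => G i ∘ₗ fgradAdj (n i) (liftEquiv (τ i ν) ι)))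
        (fun y y' => mT * (κ * (c35 * (g i).M * α₀)) * θ i * Real.exp (-(δ * (g i).dist y y')))) :
    NE2PlusOperatorM1 c35 (fun i => bgInstanceM₂R (blk i) (π i) (nsh i) (Bc i) (Bf i) (P i))
      (fun i => bgFamilyM₂RCC J ι (blk i) (π i) (nsh i) (Bc i) (Bf i) (P i) (cfgF i) (cfgC i) (τ i) (τ' i) (n i) (n' i) (ν i) (G i) (D₃ i) (D i) (G' i) (D₃' i) (D' i)) := by
  have hnJ : (0 : ℝ) ≤ Fintype.card J := Nat.cast_nonneg _
  have hnJ2 : (0 : ℝ) ≤ Fintype.card (J ⊕ J) := Nat.cast_nonneg _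
  have hJ1 : (1 : ℝ) ≤ 1 + Fintype.card (J ⊕ J) := le_add_of_nonneg_right hnJ2
  have hJ0 : (0 : ℝ) < 1 + Fintype.card (J ⊕ J) := lt_of_lt_of_le one_pos hJ1
  have hκc : 0 < κ * c35 := mul_pos hκ hc35
  -- the guard constant of the perturbation series and the by-parts one
  set a₁ : ℝ := (2 * ((κ * c35) * (1 + Fintype.card (J ⊕ J))) * (β * cr + 1))⁻¹ with ha₁_def
  set a₂ : ℝ := (2 * ((cT + 1) * (κ * c35) * Fintype.card J * β * (cr * cr * cr) + 1))⁻¹ with ha₂_def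
  have hden₁ : 0 < 2 * ((κ * c35) * (1 + Fintype.card (J ⊕ J))) * (β * cr + 1) := by positivity
  have hden₂ : 0 < 2 * ((cT + 1) * (κ * c35) * Fintype.card J * β * (cr * cr * cr) + 1) := by positivity
  have ha₁ : 0 < a₁ := inv_pos.2 hden₁
  have ha₂ : 0 < a₂ := inv_pos.2 hden₂
  set a₀ : ℝ := min (min a₁ a₂) (r₀ / c35) with ha₀_def
  have ha₀ : 0 < a₀ := lt_min (lt_min ha₁ ha₂) (div_pos hr₀ hc35)
  have ha₀₁ : a₀ ≤ a₁ := (min_le_left _ _).trans (min_le_left _ _)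
  have ha₀₂ : a₀ ≤ a₂ := (min_le_left _ _).trans (min_le_right _ _)
  have ha₀r : c35 * a₀ ≤ r₀ := by
    have h := min_le_right (min a₁ a₂) (r₀ / c35)
    rw [← ha₀_def] at h
    calc c35 * a₀ ≤ c35 * (r₀ / c35) := mul_le_mul_of_nonneg_left h hc35.le
      _ = r₀ := mul_div_cancel₀ r₀ hc35.ne'
  have hA0 : 0 ≤ κ * c35 * a₀ := by positivity
  have hq : β * ((1 + Fintype.card (J ⊕ J)) * (κ * c35 * a₀)) * cr ≤ 1 / 2 := by
    have hq₁ : β * ((1 + Fintype.card (J ⊕ J)) * (κ * c35 * a₁)) * cr ≤ 1 / 2 := by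
      have h1 : β * ((1 + Fintype.card (J ⊕ J)) * (κ * c35 * a₁)) * cr = (β * cr) * ((κ * c35) * (1 + Fintype.card (J ⊕ J)) * a₁) := by ring
      have h2 : (κ * c35) * (1 + Fintype.card (J ⊕ J)) * a₁ = (2 * (β * cr + 1))⁻¹ := by
        rw [ha₁_def]; field_simp
      rw [h1, h2, ← div_eq_mul_inv, div_le_iff₀ (by positivity)]
      nlinarith [mul_nonneg hβ hcr]
    refine le_trans ?_ hq₁
    have h0 : 0 ≤ β * ((1 + Fintype.card (J ⊕ J)) * (κ * c35)) * cr := by positivity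
    nlinarith
  have hq2 : 1 * rowConst (Fintype.card J) β cT (κ * c35 * a₀) cr * cr * cr ≤ 1 / 2 :=
    rowConst_small hnJ hβ hcT hκc.le hcr ha₀₂
  have hC0 : 0 ≤ bgConst β cr m₀ (1 + Fintype.card (J ⊕ J)) (κ * c35 * a₀) := bgConst_nonneg hβ hcr hm₀ hJ0.le hA0
  have hC1 : 0 ≤ bgConst1 β cr m₀ (1 + Fintype.card (J ⊕ J)) (κ * c35 * a₀) := bgConst1_nonneg hβ hcr hm₀ hJ0.le hA0
  have hmT' : 0 ≤ mT * (κ * c35 * a₀) := mul_nonneg hmT hA0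
  have hC2 : 0 ≤ bpConst2L (Fintype.card J) (Fintype.card (J ⊕ J)) β cr m₀ (κ * c35 * a₀) cT (mT * (κ * c35 * a₀)) :=
    bpConst2L_nonneg hnJ hnJ2 hβ hcr hm₀ hA0 hcT hmT' (by linarith)
  have hCC1 : 0 ≤ covConst1 β cr m₀ (1 + Fintype.card (J ⊕ J)) (κ * c35 * a₀) := covConst1_nonneg hβ hcr hm₀ hJ0.le hA0
  have hCC3 : 0 ≤ covConst3 (Fintype.card J) β cr m₀ (1 + Fintype.card (J ⊕ J)) (κ * c35 * a₀) := covConst3_nonneg hnJ hβ hcr hm₀ hJ0.le hA0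
  have hCC2 : 0 ≤ covConst2 (Fintype.card ι) (Fintype.card J) (Fintype.card (J ⊕ J)) β cr m₀ (κ * c35 * a₀) cT (mT * (κ * c35 * a₀)) :=
    covConst2_nonneg (Nat.cast_nonneg _) hnJ hnJ2 hβ hcr hm₀ hA0 hcT hmT' (by linarith)
  refine ⟨δ - 6 * σ, a₀, bgConst β cr m₀ (1 + Fintype.card (J ⊕ J)) (κ * c35 * a₀) + bgConst1 β cr m₀ (1 + Fintype.card (J ⊕ J)) (κ * c35 * a₀) +
    bpConst2L (Fintype.card J) (Fintype.card (J ⊕ J)) β cr m₀ (κ * c35 * a₀) cT (mT * (κ * c35 * a₀)) +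
    covConst1 β cr m₀ (1 + Fintype.card (J ⊕ J)) (κ * c35 * a₀) + covConst2 (Fintype.card ι) (Fintype.card J) (Fintype.card (J ⊕ J)) β cr m₀ (κ * c35 * a₀) cT (mT * (κ * c35 * a₀)) +
    covConst3 (Fintype.card J) β cr m₀ (1 + Fintype.card (J ⊕ J)) (κ * c35 * a₀) + 1, γ, by linarith, ha₀, by linarith, hγ, fun i α₀ hα₀ hMα U hreg => ?_⟩
  have hM' : 1 ≤ (g i).M := hM1 i
  have hMα' : (g i).M * α₀ ≤ a₀ := hMα
  have hgd : c35 * (g i).M * α₀ ≤ r₀ := by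
    calc c35 * (g i).M * α₀ = c35 * ((g i).M * α₀) := by ring
      _ ≤ c35 * a₀ := mul_le_mul_of_nonneg_left hMα' hc35.le
      _ ≤ r₀ := ha₀r
  have hsc : κ * (c35 * (g i).M * α₀) ≤ κ * c35 * a₀ := by
    calc κ * (c35 * (g i).M * α₀) = κ * c35 * ((g i).M * α₀) := by ring
      _ ≤ κ * c35 * a₀ := mul_le_mul_of_nonneg_left hMα' hκc.le
  -- the letters and the shift-defect row letter under the guard: scale `κc₃₅Mα₀ ≤ κc₃₅a₀`, window `c₃₅Mα₀ ≤ c₃₅a₀ ≤ r₀`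
  have hLt' : TwoSidedLetters J ι (π i) (τ i) (τ' i) (n i) (n' i) (κ * c35 * a₀) (θ i) (cfgF i U) (cfgC i U) :=
    (hLt i U α₀ hreg hα₀ hM' hgd).mono hsc (hθ i)
  have hDSh' : ∀ μ, HasMaj (BlockNorm.ofBlocks (g i) (liftBlk (liftBlk (blk i) ι) J)) (BlockNorm.ofBlocks (g i) (liftBlk (blk i ∘ π i) ι))
      (idef (pull (liftMap (π i) ι)) (pull (liftMap (π i) ι)) (pull (liftEquiv (τ' i μ) ι)) (pull (liftEquiv (τ i μ) ι)) ∘ₗ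
        (mmulOp ((cfgC i U).2 (Sum.inl μ) ∘ ⇑(τ i μ).symm) ∘ₗ sumJ fun ν => G i ∘ₗ fgradAdj (n i) (liftEquiv (τ i ν) ι)))
      (fun y y' => mT * (κ * c35 * a₀) * θ i * Real.exp (-(δ * (g i).dist y y'))) := fun μ =>
    (hDSh i U α₀ hreg hα₀ hM' hgd μ).mono fun y y' => by
      have h2 : 0 ≤ θ i * Real.exp (-(δ * (g i).dist y y')) := mul_nonneg (hθ i) (Real.exp_nonneg _)
      nlinarith [mul_le_mul_of_nonneg_left hsc hmT]
  have key := etaRateIneq342_twoSidedCovAll_of_letters (J := J) (ι := ι) (B := Bf i) (blk i) (π i) (htri i) (hd i) (hd0 i) hσ hcr (hrow i) (hη i) (hL i) (hlen i) hσδ.le hβ hm₀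
    (hθ i) (hθγ i) hA0 hq hcT hmT' hq2 (hn'0 i) (hn'n i) (hnθ i) (hθ1 i) (ν := ν i) (hG i) (hD i) (hG' i) (hD' i) (hD₃' i) (hDG i) (hDD i) (hDD₃ i) (hS i) (hS' i) (hDS i)
    (hSh i) (hSh' i) (cfgF := cfgF i) (cfgC := cfgC i) (U := U) hLt' hDSh'
  intro k lam y y' hs
  refine (key k lam y y' hs).trans ?_
  have hpref : 0 ≤ B9.pref4 ((bgInstanceM₂R (blk i) (π i) (nsh i) (Bc i) (Bf i) (P i)).gc.len y) k := by
    have : 1 ≤ B9.pref4 ((opGeo (g i) (X i × ι) (liftBlk (blk i) ι)).len y) k := by rw [opGeo_len]; exact one_le_pref4 (hlen i y) k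
    exact zero_le_one.trans this
  have hrf : 0 ≤ max (rateFactor (bgInstanceM₂R (blk i) (π i) (nsh i) (Bc i) (Bf i) (P i)).gc γ y) (rateFactor (bgInstanceM₂R (blk i) (π i) (nsh i) (Bc i) (Bf i) (P i)).gc γ y') :=
    (T4EtaRate.rateFactor_nonneg (g := opGeo (g i) (X i × ι) (liftBlk (blk i) ι)) (hη i).le (hL i).le γ y).trans (le_max_left _ _)
  have hnorm : 0 ≤ (bgInstanceM₂R (blk i) (π i) (nsh i) (Bc i) (Bf i) (P i)).gc.supNorm lam := Real.iSup_nonneg fun x => abs_nonneg _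
  have hE : 0 ≤ Real.exp (-((δ - 6 * σ) * (bgInstanceM₂R (blk i) (π i) (nsh i) (Bc i) (Bf i) (P i)).gc.dist y y')) := Real.exp_nonneg _
  exact mul_le_mul_of_nonneg_right (mul_le_mul_of_nonneg_right (mul_le_mul_of_nonneg_right
    (mul_le_mul_of_nonneg_right (le_add_of_nonneg_right zero_le_one) hpref) hE) hrf) hnorm

end Node

end Summit.QuantumFields.YangMills.BalabanUVNodes.N15.BackgroundLayer

end
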